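import Summits.QuantumFields.BalabanUV.T4Continuum.Spine.CovariantAveragingTower

/-!
# T⁴ programme, spine node NE2 (U1a) — THE COVARIANT INJECTED TOWER: one-step law MODULO INJECTIONS ⟹ Cauchy tower with
# rate (kernel reduction), and the U ≠ 1 wall input of NE2 for the UN-SANDWICHED objects (minimisers `H_k`, maps
# `G_kQ_kᴴ`) TYPED as a named `Prop`

Eighth generation of the NE2 prover lineage P1 of the cell `pub-balaban`, file 9 (companion of `Spine/CovariantAveragingTower`).
`Spine/CovariantAveragingTower` treats SANDWICHED level objects `A X Aᴴ` (covariances of averaged fields), which live on one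
fixed space after averaging down to the unit lattice.  The other half of node U1a's objects — the minimisers `H_k` (3.126),
the soft minimiser maps `a_kG_kQ_k^*` ([King1986] (4.2); [Balaban1984PropagatorsI] (1.71)/(1.74)) — map the unit lattice INTO
the level-`k` lattice, so consecutive levels can only be compared THROUGH AN INJECTION `J_k : ℓ²(T_{L^{−k}}) → ℓ²(T_{L^{−k−1}})`
(King's pairing «When x′ ∈ T_{η′}, we denote by x that point in T_η for which x′ ∈ B^n(x)», p. 664, or the spectral
injection of `B5G183RateTorus.Jmat`).  This file isolates that bookkeeping:

 * §1 composite injections `Jtow J k n : ι k → ι (k+n)` of one-step injections `J k` with `‖J k‖ ≤ 1`, `‖Jtow J k n‖ ≤ 1`;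
 * §2 the ONE-STEP INJECTED LAW `OneStepInjectedLaw J Mk e` (`‖M_{k+1} − J_k M_k‖ ≤ e_k`, a named `Prop`) and the reductions
   **`opNorm_sub_Jtow_mul_le_sum`** (`‖M_{k+n} − J_{k,n}M_k‖ ≤ Σ_{i<n} e_{k+i}`), **`opNorm_sub_Jtow_mul_le_geom`** (`e_k = Cρ^k`,
   `0 ≤ ρ < 1` ⇒ `≤ Cρ^k/(1 − ρ)`: a CAUCHY TOWER MODULO INJECTIONS with geometric rate — the shape of [King1986] Prop. 3.8
   (3.71)), **`opNorm_sub_Jtow_mul_le_tsum`** (summable errors ⇒ `≤ Σ_m e_{k+m}`).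

THE WALL, TYPED.  At `U ≠ 1` (`J k` = covariant injections, `Mk k = H_k(U_k)` or `G_k(U_k)Q(U_k)ᴴ`) an instance of
`OneStepInjectedLaw` with `e_k = C((B),(B^μ))·L^{−k}` is the un-sandwiched half of the cell's ONE-STEP COVARIANT COMPARISON
= open row G-an2-4: NOT IN PRINT ([B5]/[B6]/[B9] print η-uniform bounds only), asserted by nobody; a hypothesis shape here.
At `U = 1` it is a THEOREM for Bałaban's soft minimiser map with King's pairing (`Support/BalabanMinimizerLaw.
opNorm_Mtil_succ_sub_le`, `e_k = a·CQH·L^{−k}`; instance recorded in `Spine/NE2UnitLayer`).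

HONEST FRAMING (T4-DAG p. 1).  [folklore]-level bookkeeping (telescoping, geometric series), statements OURS; rung (B)+1 on a
FIXED FINITE torus, linear layer, operator norm; no conditional of the cell used or hidden (at `U ≠ 1` they enter the
constant of the hypothesis, displayed by whoever instantiates it); NOT infinite volume, NOT a mass gap, NOT Clay, NOT summit
progress.  HONEST DEPENDENCY: continuum YM on T⁴ ⇐ BetaPertH ∧ nine spine estimates (0/9 proved); BetaPertH ⇐ (D1) ∧ (D4)
∧ CAP+tail; G-an2-4 gates asym, D1 and NE2/3/4.  ABSOLUTE RULE kept; imports the companion Spine file only; no `sorry`.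
-/

noncomputable section

open scoped Matrix Matrix.Norms.L2Operator
open Filter Topology

namespace Summit.QuantumFields.BalabanUV.T4Continuum.CovariantInjectedTower

open Summit.QuantumFields.BalabanUV.T4Continuum

variable {ι : ℕ → Type*} [∀ k, Fintype (ι k)] [∀ k, DecidableEq (ι k)] {κ : Type*} [Fintype κ] [DecidableEq κ]

/-! ## §1 Composite injections -/

/-- the COMPOSITE INJECTION over `n` levels: `Jtow J k 0 = 1`, `Jtow J k (n+1) = J (k+n) · Jtow J k n`. [folklore] -/
def Jtow (J : (k : ℕ) → Matrix (ι (k + 1)) (ι k) ℂ) (k : ℕ) : (n : ℕ) → Matrix (ι (k + n)) (ι k) ℂ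
  | 0 => 1
  | n + 1 => J (k + n) * Jtow J k n

/-- `Jtow J k 0 = 1` (definitional). [folklore] -/
@[simp] theorem Jtow_zero (J : (k : ℕ) → Matrix (ι (k + 1)) (ι k) ℂ) (k : ℕ) : Jtow J k 0 = 1 := rfl

/-- the recursion step (definitional). [folklore] -/
@[simp] theorem Jtow_succ (J : (k : ℕ) → Matrix (ι (k + 1)) (ι k) ℂ) (k n : ℕ) :
    Jtow J k (n + 1) = J (k + n) * Jtow J k n := rfl

/-- `‖Jtow J k n‖ ≤ 1` when every `‖J k‖ ≤ 1`. [folklore] -/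
theorem opNorm_Jtow_le (J : (k : ℕ) → Matrix (ι (k + 1)) (ι k) ℂ) (hJ : ∀ k, ‖J k‖ ≤ 1) (k n : ℕ) :
    ‖Jtow J k n‖ ≤ 1 := by
  induction n with
  | zero => exact CovariantAveragingTower.opNorm_one_le (ι := ι) k
  | succ n ih =>
    rw [Jtow_succ]
    calc ‖J (k + n) * Jtow J k n‖ ≤ ‖J (k + n)‖ * ‖Jtow J k n‖ := Matrix.l2_opNorm_mul _ _
      _ ≤ 1 * 1 := mul_le_mul (hJ _) ih (norm_nonneg _) zero_le_one
      _ = 1 := one_mul 1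

/-! ## §2 The one-step injected law (hypothesis shape) and what it yields -/

/-- **THE ONE-STEP INJECTED LAW** with error sequence `e`: `‖M_{k+1} − J_k M_k‖ ≤ e_k` for every `k` — the level-`(k+1)`
object, compared with the injected level-`k` object.  AT `U = 1`: a theorem for Bałaban's soft minimiser map and King's
pairing (`Support/BalabanMinimizerLaw.opNorm_Mtil_succ_sub_le`).  AT `U ≠ 1` (`Mk k = H_k(U_k)`, `G_k(U_k)Q(U_k)ᴴ`, covariant
injections): the un-sandwiched half of the ONE-STEP COVARIANT COMPARISON = open row G-an2-4 — NOT IN PRINT, asserted by nobody;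
a HYPOTHESIS SHAPE. [folklore] -/
def OneStepInjectedLaw (J : (k : ℕ) → Matrix (ι (k + 1)) (ι k) ℂ) (Mk : (k : ℕ) → Matrix (ι k) κ ℂ) (e : ℕ → ℝ) : Prop :=
  ∀ k, ‖Mk (k + 1) - J k * Mk k‖ ≤ e k

/-- **partial sums**: `‖M_{k+n} − J_{k,n} M_k‖ ≤ Σ_{i<n} e_{k+i}` (telescoping; injections have norm `≤ 1`). [folklore] -/
theorem opNorm_sub_Jtow_mul_le_sum (J : (k : ℕ) → Matrix (ι (k + 1)) (ι k) ℂ) (hJ : ∀ k, ‖J k‖ ≤ 1)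
    (Mk : (k : ℕ) → Matrix (ι k) κ ℂ) {e : ℕ → ℝ} (hlaw : OneStepInjectedLaw J Mk e) (k n : ℕ) :
    ‖Mk (k + n) - Jtow J k n * Mk k‖ ≤ ∑ i ∈ Finset.range n, e (k + i) := by
  induction n with
  | zero =>
    show ‖Mk k - 1 * Mk k‖ ≤ ∑ i ∈ Finset.range 0, e (k + i)
    rw [Matrix.one_mul, sub_self, norm_zero, Finset.range_zero, Finset.sum_empty]
  | succ n ih =>
    have e1 : ‖Mk (k + (n + 1)) - Jtow J k (n + 1) * Mk k‖
        = ‖(Mk (k + n + 1) - J (k + n) * Mk (k + n)) + J (k + n) * (Mk (k + n) - Jtow J k n * Mk k)‖ := by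
      rw [Matrix.mul_sub, ← Matrix.mul_assoc, sub_add_sub_cancel]
      rfl
    rw [e1, Finset.sum_range_succ]
    calc _ ≤ ‖Mk (k + n + 1) - J (k + n) * Mk (k + n)‖ + ‖J (k + n) * (Mk (k + n) - Jtow J k n * Mk k)‖ := norm_add_le _ _
      _ ≤ e (k + n) + 1 * ∑ i ∈ Finset.range n, e (k + i) := by
          refine add_le_add (hlaw (k + n)) ?_
          exact (Matrix.l2_opNorm_mul _ _).trans (mul_le_mul (hJ _) ih (norm_nonneg _) zero_le_one)
      _ = ∑ i ∈ Finset.range n, e (k + i) + e (k + n) := by ring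

/-- **CAUCHY TOWER MODULO INJECTIONS, geometric errors** `e_k = Cρ^k`, `0 ≤ ρ < 1`: `‖M_{k+n} − J_{k,n}M_k‖ ≤ Cρ^k/(1 − ρ)` for all
`k, n` — the shape of [King1986] Prop. 3.8 (3.71) (printed pointwise, with decay and rate `CL^{−γk}`) in operator norm, for any
injected tower (v1.0.1: docstring only — no printed string is quoted here). [folklore] -/
theorem opNorm_sub_Jtow_mul_le_geom (J : (k : ℕ) → Matrix (ι (k + 1)) (ι k) ℂ) (hJ : ∀ k, ‖J k‖ ≤ 1)
    (Mk : (k : ℕ) → Matrix (ι k) κ ℂ) {C ρ : ℝ} (hρ0 : 0 ≤ ρ) (hρ1 : ρ < 1)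
    (hlaw : OneStepInjectedLaw J Mk (fun k => C * ρ ^ k)) (k n : ℕ) :
    ‖Mk (k + n) - Jtow J k n * Mk k‖ ≤ C * ρ ^ k / (1 - ρ) := by
  have hC : 0 ≤ C := by
    have h0 := (norm_nonneg _).trans (hlaw 0)
    simpa using h0
  refine (opNorm_sub_Jtow_mul_le_sum J hJ Mk hlaw k n).trans ?_
  have e1 : ∑ i ∈ Finset.range n, C * ρ ^ (k + i) = C * ρ ^ k * ∑ i ∈ Finset.Ico 0 n, ρ ^ i := by
    rw [Finset.mul_sum, Finset.range_eq_Ico]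
    refine Finset.sum_congr rfl fun i _ => ?_
    rw [pow_add]; ring
  have h := geom_sum_Ico_le_of_lt_one hρ0 hρ1 (m := 0) (n := n)
  rw [pow_zero, one_div] at h
  calc ∑ i ∈ Finset.range n, (fun k => C * ρ ^ k) (k + i) = C * ρ ^ k * ∑ i ∈ Finset.Ico 0 n, ρ ^ i := e1
    _ ≤ C * ρ ^ k * (1 - ρ)⁻¹ := mul_le_mul_of_nonneg_left h (mul_nonneg hC (pow_nonneg hρ0 k))
    _ = C * ρ ^ k / (1 - ρ) := (div_eq_mul_inv _ _).symm

/-- **summable errors**: `‖M_{k+n} − J_{k,n}M_k‖ ≤ Σ_m e_{k+m}` for all `n` (`e ≥ 0` summable). [folklore] -/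
theorem opNorm_sub_Jtow_mul_le_tsum (J : (k : ℕ) → Matrix (ι (k + 1)) (ι k) ℂ) (hJ : ∀ k, ‖J k‖ ≤ 1)
    (Mk : (k : ℕ) → Matrix (ι k) κ ℂ) {e : ℕ → ℝ} (he0 : ∀ k, 0 ≤ e k) (he : Summable e)
    (hlaw : OneStepInjectedLaw J Mk e) (k n : ℕ) :
    ‖Mk (k + n) - Jtow J k n * Mk k‖ ≤ ∑' m, e (k + m) := by
  refine (opNorm_sub_Jtow_mul_le_sum J hJ Mk hlaw k n).trans ?_
  have hs : Summable fun m => e (k + m) := he.comp_injective (add_right_injective k)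
  exact hs.sum_le_tsum (Finset.range n) (fun m _ => he0 (k + m))

end Summit.QuantumFields.BalabanUV.T4Continuum.CovariantInjectedTower

end
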